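import Mathlib

/-!
# Elementary cores of the apex theorem (DENSITY-XY G.40–G.43)

Kernel anchors for `DENSITY-XY.md` ADDENDUM G.40–G.45 (repair cell b2b-imbrie, XY / free-fermion rung,
THEOREM A: `K_n(ν) ≤ Σ_τ ∏_m φ(g_m(τ)) ≤ 2^{n-1} n!` on 2-separated spectra).  Checked here:

* `pair_sum_ge` — LEMMA L0 in pair form: for a probability vector `ρ` on a `2`-separated configuration
  `x` with all masses `≤ p`, the pair sum `Σᵢ Σⱼ ρᵢ ρⱼ (xᵢ - xⱼ)² ≥ 4 (1 - p)` (this pair sum is twice the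
  variance, so an atom of mass `≥ 1 - Var/2` exists);
* `two_atom_sq` — the polynomial core of LEMMA T′: `p q g² + 4 s (p+q) ≤ 1`, `s = 1 - p - q ≥ 0`,
  `p + q ≥ 1/3` imply `p q g² ≤ (p+q)²`;
* `two_atom_root` — its consequence `2 √(q/p) ≤ g - √(g² - 4)` for `0 < q ≤ p`, `g ≥ 2`, i.e. the
  T-weight ratio bound `q/p ≤ u₊(g)⁻²` of LEMMA B♯;
* `phi_le_two`, `one_le_phi`, `phi_sub_one_le` — the bond factor `φ(g) = 2g/(g + √(g²-4))` lies in
  `[1, 2]` and `φ(g) - 1 ≤ 4/g²` (the universal majorant `E_τ ∏ (1 + k_m⁻²)` of THEOREM A).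

Elementary real algebra only; nothing here asserts anything about the interacting chain (LLA).
-/

namespace Literature.MathematicalPhysics.QuantumLattice.Imbrie2016

open Finset

/-- **L0, pair form.**  `ρ ≥ 0`, `Σ ρ = 1`, `ρ ≤ p` pointwise, `(xᵢ - xⱼ)² ≥ 4` for `i ≠ j` imply
`4 (1 - p) ≤ Σᵢ Σⱼ ρᵢ ρⱼ (xᵢ - xⱼ)²`.  [folklore] -/
theorem pair_sum_ge {N : ℕ} (ρ x : Fin N → ℝ) (p : ℝ) (hρ : ∀ i, 0 ≤ ρ i)
    (hsum : ∑ i, ρ i = 1) (hp : ∀ i, ρ i ≤ p)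
    (hsep : ∀ i j, i ≠ j → 4 ≤ (x i - x j) ^ 2) :
    4 * (1 - p) ≤ ∑ i, ∑ j, ρ i * ρ j * (x i - x j) ^ 2 := by
  -- pointwise minorant: ρ i ρ j (x i - x j)^2 ≥ 4 ρ i ρ j - 4 ρ i ρ j [i = j] ≥ 4 ρ i ρ j - 4 ρ i p [i = j]
  have key : ∀ i j, 4 * (ρ i * ρ j) - (if i = j then 4 * (ρ i * p) else 0) ≤
      ρ i * ρ j * (x i - x j) ^ 2 := by
    intro i j
    by_cases h : i = j
    · subst h
      simp only [if_true, sub_self, zero_pow two_ne_zero, mul_zero]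
      have := hp i
      nlinarith [hρ i]
    · simp only [h, if_false, sub_zero]
      have h4 := hsep i j h
      have := mul_nonneg (hρ i) (hρ j)
      nlinarith
  have step : ∑ i, ∑ j, (4 * (ρ i * ρ j) - (if i = j then 4 * (ρ i * p) else 0)) ≤
      ∑ i, ∑ j, ρ i * ρ j * (x i - x j) ^ 2 := by
    apply Finset.sum_le_sum; intro i _
    apply Finset.sum_le_sum; intro j _
    exact key i j
  have lhs : ∑ i, ∑ j, (4 * (ρ i * ρ j) - (if i = j then 4 * (ρ i * p) else 0)) = 4 - 4 * p := by
    simp only [Finset.sum_sub_distrib, Finset.sum_ite_eq, Finset.mem_univ, if_true]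
    rw [← Finset.sum_sub_distrib]
    have : ∀ i, (∑ j, 4 * (ρ i * ρ j)) - 4 * (ρ i * p) = ρ i * (4 - 4 * p) := by
      intro i
      rw [← Finset.mul_sum]
      simp_rw [← Finset.mul_sum, hsum]
      ring
    simp_rw [this, ← Finset.sum_mul, hsum]
    ring
  linarith

/-- **T′, polynomial core.**  If `0 ≤ q ≤ p`, `s = 1 - p - q ≥ 0`, `p + q ≥ 1/3` and the variance
minorant `p q g² + 4 s (p + q) ≤ 1`, then `p q g² ≤ (p + q)²`.  [folklore] -/
theorem two_atom_sq (p q g s : ℝ) (_hq : 0 ≤ q) (_hqp : q ≤ p) (hs : s = 1 - p - q) (hs0 : 0 ≤ s)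
    (ht : 1 / 3 ≤ p + q) (hV : p * q * g ^ 2 + 4 * s * (p + q) ≤ 1) :
    p * q * g ^ 2 ≤ (p + q) ^ 2 := by
  subst hs
  nlinarith

/-- **T′, ratio form.**  If moreover `0 < p` and `g ≥ 2`, then `2 √(q/p) ≤ g - √(g² - 4)`, i.e.
`√(q/p) ≤ u₋(g) = u₊(g)⁻¹`.  [folklore] -/
theorem two_atom_root (p q g : ℝ) (hp : 0 < p) (hq : 0 ≤ q) (hqp : q ≤ p) (hg : 2 ≤ g)
    (h : p * q * g ^ 2 ≤ (p + q) ^ 2) :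
    2 * Real.sqrt (q / p) ≤ g - Real.sqrt (g ^ 2 - 4) := by
  set x := Real.sqrt (q / p) with hx
  have hr0 : 0 ≤ q / p := div_nonneg hq hp.le
  have hr1 : q / p ≤ 1 := by rw [div_le_one hp]; exact hqp
  have hx0 : 0 ≤ x := Real.sqrt_nonneg _
  have hx1 : x ≤ 1 := by
    rw [hx]; calc Real.sqrt (q / p) ≤ Real.sqrt 1 := Real.sqrt_le_sqrt hr1
      _ = 1 := Real.sqrt_one
  have hxx : x ^ 2 = q / p := by rw [hx]; exact Real.sq_sqrt hr0
  -- from h: g^2 (q/p) ≤ (1 + q/p)^2, hence g x ≤ 1 + x^2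
  have h1 : g ^ 2 * (q / p) ≤ (1 + q / p) ^ 2 := by
    have e1 : g ^ 2 * (q / p) = (p * q * g ^ 2) / p ^ 2 := by
      field_simp
    have e2 : (1 + q / p) ^ 2 = (p + q) ^ 2 / p ^ 2 := by
      field_simp
    rw [e1, e2]
    gcongr
  have h2 : g * x ≤ 1 + x ^ 2 := by
    have hgx : 0 ≤ g * x := mul_nonneg (by linarith) hx0
    have hsq : (g * x) ^ 2 ≤ (1 + x ^ 2) ^ 2 := by rw [mul_pow, hxx]; exact h1
    have t : 0 < g * x + (1 + x ^ 2) := by positivity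
    nlinarith [hsq, t]
  -- conclude: √(g²-4) ≤ g - 2x since (g - 2x)² ≥ g² - 4 ⟺ g x ≤ 1 + x²
  have hg2x : 0 ≤ g - 2 * x := by linarith
  have : Real.sqrt (g ^ 2 - 4) ≤ g - 2 * x := by
    calc Real.sqrt (g ^ 2 - 4) ≤ Real.sqrt ((g - 2 * x) ^ 2) := Real.sqrt_le_sqrt (by nlinarith)
      _ = g - 2 * x := Real.sqrt_sq hg2x
  linarith

/-- The bond factor of THEOREM A, `φ(g) = 2g/(g + √(g²-4))`.  [folklore] -/
noncomputable def phi (g : ℝ) : ℝ := 2 * g / (g + Real.sqrt (g ^ 2 - 4))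

/-- `φ(g) ≤ 2` for `g ≥ 2`.  [folklore] -/
theorem phi_le_two (g : ℝ) (hg : 2 ≤ g) : phi g ≤ 2 := by
  unfold phi
  have hs : 0 ≤ Real.sqrt (g ^ 2 - 4) := Real.sqrt_nonneg _
  have hd : 0 < g + Real.sqrt (g ^ 2 - 4) := by linarith
  rw [div_le_iff₀ hd]
  linarith

/-- `1 ≤ φ(g)` for `g ≥ 2`.  [folklore] -/
theorem one_le_phi (g : ℝ) (hg : 2 ≤ g) : 1 ≤ phi g := by
  unfold phi
  have hs : Real.sqrt (g ^ 2 - 4) ≤ g := by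
    calc Real.sqrt (g ^ 2 - 4) ≤ Real.sqrt (g ^ 2) := Real.sqrt_le_sqrt (by linarith)
      _ = g := Real.sqrt_sq (by linarith)
  have hd : 0 < g + Real.sqrt (g ^ 2 - 4) := by linarith [Real.sqrt_nonneg (g ^ 2 - 4)]
  rw [le_div_iff₀ hd]
  linarith

/-- `φ(g) - 1 ≤ 4 / g²` for `g ≥ 2` (indeed `φ(g) - 1 = 4/(g + √(g²-4))²`).  [folklore] -/
theorem phi_sub_one_le (g : ℝ) (hg : 2 ≤ g) : phi g - 1 ≤ 4 / g ^ 2 := by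
  unfold phi
  set r := Real.sqrt (g ^ 2 - 4) with hr
  have hr0 : 0 ≤ r := Real.sqrt_nonneg _
  have hrr : r ^ 2 = g ^ 2 - 4 := by rw [hr]; exact Real.sq_sqrt (by nlinarith)
  have hd : 0 < g + r := by linarith
  have hg0 : 0 < g := by linarith
  -- φ - 1 = (g - r)/(g + r) = 4/(g+r)^2 ≤ 4/g^2
  rw [div_sub_one hd.ne', div_le_div_iff₀ hd (by positivity)]
  nlinarith [hrr, hr0, hg0, mul_nonneg hr0 hg0.le]

end Literature.MathematicalPhysics.QuantumLattice.Imbrie2016
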